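import Summits.HodgeConjecture.HodgeConjecture.Theses.LinearSystemTorelli
import Literature.AlgebraicGeometry.HodgeTheory.ComplexGysinCorrespondence
import Literature.AlgebraicGeometry.HodgeTheory.ComplexGysinHodgeType
import Literature.AlgebraicGeometry.HodgeTheory.AlgebraicClassesHodgeTypeHolds
import Literature.AlgebraicGeometry.HodgeTheory.HodgeFiltrationModelsReductionProofs
import Literature.AlgebraicGeometry.HodgeTheory.ComplexConjugationHolds
import Literature.NumberTheory.Transcendental.DeRhamTheoremMultiplicative

/-!
# Crux `TranscendentalOrSupported` (stmt-HodgeConjecture-10853), line `Sketch_chow_shadow` — stub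
# `stub_corrActionType`: an algebraic self-correspondence acts with Hodge bidegree `(0, 0)`

Helper file for the line skeleton `Sketch_chow_shadow` (cohomological transcendental decomposition
of the diagonal) of the crux `TranscendentalOrSupported` of route `LinearSystemTorelli`
(GHC(2p, coniveau 1) in Grothendieck's sub-Hodge form), registered stub `stub_corrActionType`.

Notation: `X` smooth projective of dimension `n`, `μ` an orientation family, `A` a Hodge model of
`X` (`A.pullback k = A^* : Hᵏ(X(ℂ); ℂ) → Hᵏ(X^an; ℂ)` the bijective comparison,
`A.hodgePQ k p' q' = H^{p',q'}` the pieces of its Hodge decomposition), `γ ∈ H^{2n}((X ⊗ X)(ℂ); ℂ)`,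
and `γ^* = corrAction μ hX hX hab γ : Hᵏ(X(ℂ); ℂ) →ₗ Hᵏ(X(ℂ); ℂ)`, `γ^*(c) = pr_{1*}(pr_2^* c ∪ γ)`
(`corrAction_apply`; `pr_{1*} = complexGysin μ (tensor_holds hX hX) hX (fst X X) _`,
`pr_2^* = complexBetti.map (snd X X) k`).

CLAIM (`stub_corrActionType`; C. Voisin, *Hodge Theory and Complex Algebraic Geometry I* (2002),
§7.3.2 and Lemma 11.41: the class of an algebraic cycle of codimension `dim X` on `X × X` induces a
morphism of Hodge structures `Hᵏ(X) → Hᵏ(X)`). For `γ ∈ algebraicClasses (X ⊗ X) n` and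
`c ∈ Hᵏ(X(ℂ); ℂ)` with `A^* c ∈ H^{p',q'}`, also `A^* (γ^* c) ∈ H^{p',q'}`.

PROOF. Choose a Hodge model `C` of `X ⊗ X` (`nonempty_hodgeModel_holds`, `X ⊗ X` smooth projective of
dimension `n + n` by `IsSmoothProjective.tensor_holds`). (1) `c` is of type `(p', q')` (witness `A`);
(2) `pr_2^* c` is of type `(p', q')` on `X ⊗ X` (`IsOfHodgeType.map_of_independent`); (3) `γ` is of
type `(n, n)` (`isOfHodgeType_of_mem_algebraicClasses_of_isSmoothProjective`, Voisin I Prop. 11.20);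
(4) `pr_2^* c ∪ γ` is of type `(p' + n, q' + n)` (`cupPreservesHodgeType_of_nonempty_hodgeModel`, de
Rham's theorem in multiplicative form `exists_deRhamIsoFamily_holds`); (5) `pr_{1*}` has bidegree
`(-n, -n)` (`isOfHodgeType_complexGysin`, Voisin I §7.3.2 with Lemma 7.30); (6) the resulting
`∃`-over-models type `(p', q')` of `γ^* c` is read in the fixed model `A`
(`hodgePQ_independent_of_hodgeModel_holds.isOfHodgeType_iff`). Uniform in `p', q'` (no case split on
`p' + q' = k`).

Pure tree theorems; no named fact is taken as a hypothesis and none is introduced.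

References: C. Voisin, *Hodge Theory and Complex Algebraic Geometry I* (CUP 2002), §7.3.2 (with
Lemma 7.30), §11.1.2 Prop. 11.20, §11.3.3 Lemma 11.41; C. Voisin, *Hodge Theory and Complex Algebraic
Geometry II* (CUP 2003), proof of Thm. 10.17, (10.7).
-/

-- `Summit.HodgeConjecture.HodgeConjecture.Theorems` is the mandated namespace (single-conjunct summit:
-- Sub = Summit), which `linter.dupNamespace` flags on every declaration; the lakefile turns the
-- linter off tree-wide (weak option), restated here so stand-alone elaboration is warning-free too.
set_option linter.dupNamespace false

noncomputable section

namespace Summit.HodgeConjecture.HodgeConjecture.Theorems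

open CategoryTheory MonoidalCategory CartesianMonoidalCategory
open Literature.AlgebraicGeometry.Motives Literature.AlgebraicGeometry.HodgeTheory
open Literature.AlgebraicTopology.SingularHomology

variable {n : ℕ} {X : SchemeOver ℂ}

/-! ### The `∃`-over-models form -/

/-- **An algebraic self-correspondence of codimension `dim X` acts with Hodge bidegree `(0, 0)`**
(`∃`-over-models form). For `X` smooth projective of dimension `n`, an orientation family `μ`,
`γ ∈ algebraicClasses (X ⊗ X) n` and `c ∈ Hᵏ(X(ℂ); ℂ)` of Hodge type `(p', q')`, the class
`γ^* c = pr_{1*}(pr_2^* c ∪ γ)` is of type `(p', q')`: `pr_2^* c` is of type `(p', q')`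
(`IsOfHodgeType.map_of_independent`), `γ` of type `(n, n)`
(`isOfHodgeType_of_mem_algebraicClasses_of_isSmoothProjective`), their cup product of type
`(p' + n, q' + n)` (`cupPreservesHodgeType_of_nonempty_hodgeModel`), and `pr_{1*}` shifts types by
`(-n, -n)` (`isOfHodgeType_complexGysin`); all fed with the theorems
`hodgePQ_independent_of_hodgeModel_holds`, `nonempty_hodgeModel_holds`, `exists_deRhamIsoFamily_holds`.
[cite: VoisinHodgeI2002, §7.3.2 (with Lemma 7.30) and Lemma 11.41] -/
theorem isOfHodgeType_corrAction_of_mem_algebraicClasses (μ : OrientationFamily)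
    (hX : IsSmoothProjective n X) {k : ℕ} (hab : k + 2 * n = k + 2 * n)
    {γ : complexBetti (X ⊗ X) (2 * n)} (hγ : γ ∈ algebraicClasses (X ⊗ X) n) {p' q' : ℕ}
    {c : complexBetti X k} (hc : IsOfHodgeType n X k p' q' c) :
    IsOfHodgeType n X k p' q' (corrAction μ hX hX hab γ c) := by
  have hI := hodgePQ_independent_of_hodgeModel_holds
  have hXX : IsSmoothProjective (n + n) (X ⊗ X) := IsSmoothProjective.tensor_holds hX hX
  -- a Hodge model of `X ⊗ X`
  obtain ⟨C⟩ := (nonempty_hodgeModel_holds (n := n + n) (X := X ⊗ X)).nonempty hXX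
  -- (2) `pr_2^* c` is of type `(p', q')`
  have h2 : IsOfHodgeType (n + n) (X ⊗ X) k p' q' (complexBetti.map (snd X X) k c) :=
    IsOfHodgeType.map_of_independent hI hc hXX hX C (snd X X)
  -- (3) `γ` is of type `(n, n)`
  have h3 : IsOfHodgeType (n + n) (X ⊗ X) (2 * n) n n γ :=
    isOfHodgeType_of_mem_algebraicClasses_of_isSmoothProjective hXX n hγ
  -- (4) `pr_2^* c ∪ γ` is of type `(p' + n, q' + n)`
  have hcup : CupPreservesHodgeType (n + n) (X ⊗ X) :=
    cupPreservesHodgeType_of_nonempty_hodgeModel hI nonempty_hodgeModel_holds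
      (fun E _ _ _ ↦ Literature.NumberTheory.Transcendental.exists_deRhamIsoFamily_holds (E := E)) hXX
  have h4 : IsOfHodgeType (n + n) (X ⊗ X) (k + 2 * n) (p' + n) (q' + n)
      (cupProduct (rfl : k + 2 * n = k + 2 * n) (complexBetti.map (snd X X) k c) γ) :=
    hcup rfl h2 h3
  -- (5) `pr_{1*}` shifts types by `(-n, -n)`
  rw [corrAction_apply]
  exact isOfHodgeType_complexGysin hI (fun _ _ ↦ nonempty_hodgeModel_holds)
    (fun E _ _ _ ↦ Literature.NumberTheory.Transcendental.exists_deRhamIsoFamily_holds (E := E))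
    μ hXX hX (fst X X) (corrAction_degree n hab) (p := p' + n) (q := q' + n) (p' := p') (q' := q')
    (by omega) (by omega) h4

/-! ### The stub -/

/-- **STUB `stub_corrActionType` (an algebraic self-correspondence acts with Hodge bidegree `(0,0)`,
read in a fixed Hodge model; Voisin I §7.3.2 and Lemma 11.41) of the crux `TranscendentalOrSupported`,
line `Sketch_chow_shadow`.** For `γ ∈ algebraicClasses (X ⊗ X) n` (`n = dim X`, so
`γ ∈ H^{2n}((X ⊗ X)(ℂ))` is of Hodge type `(n,n)` by the tree's
`isOfHodgeType_of_mem_algebraicClasses_of_isSmoothProjective`) and `c ∈ Hᵏ(X(ℂ); ℂ)` with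
`A^* c ∈ H^{p',q'}`, also `A^*(γ^* c) ∈ H^{p',q'}`: `pr_2^* c` is of type `(p',q')`
(`IsOfHodgeType.map_of_independent`), `pr_2^* c ∪ γ` of type `(p'+n, q'+n)`
(`cupPreservesHodgeType_of_nonempty_hodgeModel`), and `pr_{1*}` shifts types by `(-n,-n)`
(`isOfHodgeType_complexGysin`); all fed with the theorems `hodgePQ_independent_of_hodgeModel_holds`,
`nonempty_hodgeModel_holds`, `exists_deRhamIsoFamily_holds`, and read back in `A` by
`hodgePQ_independent_of_hodgeModel_holds.isOfHodgeType_iff`.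
[cite: VoisinHodgeI2002, §7.3.2 (with Lemma 7.30) and Lemma 11.41] -/
theorem stub_corrActionType :
    ∀ (μ : OrientationFamily) ⦃n : ℕ⦄ ⦃X : SchemeOver ℂ⦄ (hX : IsSmoothProjective n X)
    (A : HodgeModel n X) ⦃k : ℕ⦄ (hab : k + 2 * n = k + 2 * n) ⦃γ : complexBetti (X ⊗ X) (2 * n)⦄,
    γ ∈ algebraicClasses (X ⊗ X) n →
    ∀ ⦃p' q' : ℕ⦄ ⦃c : complexBetti X k⦄, A.pullback k c ∈ A.hodgePQ k p' q' →
    A.pullback k (corrAction μ hX hX hab γ c) ∈ A.hodgePQ k p' q' :=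
  fun μ _ _ hX A _ hab _ hγ _ _ _ hc ↦
    (hodgePQ_independent_of_hodgeModel_holds.isOfHodgeType_iff hX A).1
      (isOfHodgeType_corrAction_of_mem_algebraicClasses μ hX hab hγ ⟨A, hc⟩)

end Summit.HodgeConjecture.HodgeConjecture.Theorems

end
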